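import Summits.FinalStateConjecture.FinalStateConjecture.Theorems.PhotonSphereChannelsFrozenPacketMain

/-!
# Route PhotonSphereChannels · K1R (UniformPhotonSphereChannelsR) — far-side frozen velocity packets

Negative-side support for item stmt-FinalStateConjecture-14074 (cdisprove seat).  The landed engine
`FrozenPacket.near_energy_le_at` bounds the energy of a frozen velocity packet to the LEFT of the
packet; reflecting `x ↦ −x` gives the same bound to the RIGHT (`far_energy_le_at`), which is what
the FAR exterior cone `{x > x_f + |t|}` needs: a packet flush inside the far edge `x_f` is swept by
the edge `x_f + |t|` in time `T` = its width, and the energy ahead of it stays `≤ ε ∫ g²`.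
No definitions are introduced.
-/

noncomputable section

open Set Filter MeasureTheory Topology Function

namespace Summit.FinalStateConjecture.FinalStateConjecture.Theorems.FrozenPacket

/-- **The far-side energy at one time** (mirror image of `near_energy_le_at`).  Let `ψ ∈ C²`
solve `ψ_tt − ψ_xx + Vψ = 0` (`V ∈ C¹`, `V ≥ 0`) with data `(0, g)`, `g ∈ C²` vanishing off
`[α, β]`, `ψ` vanishing outside the domain of influence of `[α, β]`, and let `ω > 0`, `N` with
`|(V − ω²) g − g''| ≤ ω N` everywhere.  Then for `t ∈ [0, T]` the energy of `ψ` on `(β, ∞)` is at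
most `(e − 1) T² (β − α) N²`. -/
theorem far_energy_le_at {V : ℝ → ℝ} {ψ : ℝ → ℝ → ℝ} {α β : ℝ} (hV1 : ContDiff ℝ 1 V)
    (hVnn : ∀ x, 0 ≤ V x)
    (hψ : ContDiff ℝ 2 (uncurry ψ))
    (hsol : ∀ t x, iteratedDeriv 2 (fun τ => ψ τ x) t - iteratedDeriv 2 (ψ t) x + V x * ψ t x = 0)
    (hsupp : ∀ t x, (x < α - |t| ∨ β + |t| < x) → ψ t x = 0)
    (hψ0 : ∀ x, ψ 0 x = 0) {g : ℝ → ℝ} (hψ1 : ∀ x, deriv (fun τ => ψ τ x) 0 = g x)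
    (hg : ContDiff ℝ 2 g) (hg0 : ∀ x, (x < α ∨ β < x) → g x = 0)
    (hαβ : α ≤ β) {ω T N : ℝ} (hω : 0 < ω) (hT : 0 < T)
    (hres : ∀ x, |(V x - ω ^ 2) * g x - iteratedDeriv 2 g x| ≤ ω * N) :
    ∀ t ∈ Icc 0 T, ∫ x in Ioi β,
      (deriv (fun τ => ψ τ x) t ^ 2 + deriv (ψ t) x ^ 2 + V x * ψ t x ^ 2)
        ≤ (Real.exp 1 - 1) * T ^ 2 * ((β - α) * N ^ 2) := by
  -- the reflected objects
  set Vn : ℝ → ℝ := fun x => V (-x) with hVn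
  set ψn : ℝ → ℝ → ℝ := fun t x => ψ t (-x) with hψn
  set gn : ℝ → ℝ := fun x => g (-x) with hgn
  have hVn1 : ContDiff ℝ 1 Vn := hV1.comp contDiff_neg
  have hVnn' : ∀ x, 0 ≤ Vn x := fun x => hVnn _
  have hψn2 : ContDiff ℝ 2 (uncurry ψn) := by
    have : uncurry ψn = uncurry ψ ∘ fun p : ℝ × ℝ => (p.1, -p.2) := by
      ext p; rfl
    rw [this]
    exact hψ.comp (contDiff_fst.prodMk contDiff_snd.neg)
  have hi2 : ∀ (f : ℝ → ℝ) (x : ℝ), iteratedDeriv 2 (fun y => f (-y)) x = iteratedDeriv 2 f (-x) := by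
    intro f x
    rw [iteratedDeriv_comp_neg 2 f x]
    norm_num
  have hsoln : ∀ t x, iteratedDeriv 2 (fun τ => ψn τ x) t - iteratedDeriv 2 (ψn t) x
      + Vn x * ψn t x = 0 := by
    intro t x
    have h1 : iteratedDeriv 2 (ψn t) x = iteratedDeriv 2 (ψ t) (-x) := hi2 (ψ t) x
    rw [h1]
    exact hsol t (-x)
  have hsuppn : ∀ t x, (x < -β - |t| ∨ -α + |t| < x) → ψn t x = 0 := by
    intro t x hx
    show ψ t (-x) = 0
    apply hsupp
    rcases hx with h | h
    · right; linarith
    · left; linarith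
  have hψn0 : ∀ x, ψn 0 x = 0 := fun x => hψ0 _
  have hψn1 : ∀ x, deriv (fun τ => ψn τ x) 0 = gn x := fun x => hψ1 (-x)
  have hgn2 : ContDiff ℝ 2 gn := hg.comp contDiff_neg
  have hgn0 : ∀ x, (x < -β ∨ -α < x) → gn x = 0 := by
    intro x hx
    show g (-x) = 0
    apply hg0
    rcases hx with h | h
    · right; linarith
    · left; linarith
  have hαβn : -β ≤ -α := by linarith
  have hresn : ∀ x, |(Vn x - ω ^ 2) * gn x - iteratedDeriv 2 gn x| ≤ ω * N := by
    intro x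
    have : iteratedDeriv 2 gn x = iteratedDeriv 2 g (-x) := hi2 g x
    rw [this]
    exact hres (-x)
  have H := near_energy_le_at hVn1 hVnn' hψn2 hsoln hsuppn hψn0 hψn1 hgn2 hgn0 hαβn hω hT hresn
  intro t ht
  have Ht := H t ht
  -- the integrand of the reflected field is the reflected integrand
  set E : ℝ → ℝ := fun y => deriv (fun τ => ψ τ y) t ^ 2 + deriv (ψ t) y ^ 2 + V y * ψ t y ^ 2
    with hE
  have hint : ∀ x, deriv (fun τ => ψn τ x) t ^ 2 + deriv (ψn t) x ^ 2 + Vn x * ψn t x ^ 2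
      = E (-x) := by
    intro x
    have hd : deriv (ψn t) x = -deriv (ψ t) (-x) := deriv_comp_neg (ψ t) x
    rw [hd, neg_sq]
  have hL : (∫ x in Iio (-β), (deriv (fun τ => ψn τ x) t ^ 2 + deriv (ψn t) x ^ 2
      + Vn x * ψn t x ^ 2)) = ∫ x in Ioi β, E x := by
    rw [← integral_Iic_eq_integral_Iio]
    rw [setIntegral_congr_fun measurableSet_Iic (fun x _ => hint x)]
    rw [integral_comp_neg_Iic (-β) E, neg_neg]
  have hR : ((-α) - (-β)) * N ^ 2 = (β - α) * N ^ 2 := by ring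
  rw [hL, hR] at Ht
  exact Ht

open Summit.FinalStateConjecture.FinalStateConjecture.Theorems.Blindness in
/-- **The frozen velocity packet at scale `m`, far-side form.**  Verbatim the landed
`frozen_packet_main` (packet `g(x) = B(m³(x − α))` of width `T = 3/m³` on `[α, xe]`, `α = xe − T`,
`ℓ = m⁴`, global solution `ψ` with data `(0, g)`), except that the conclusion bounds the energy to
the RIGHT of the packet, on `(xe, ∞)`, at the times `±T` — the form needed by the FAR exterior cone
`{x > α + |t|}` whose edge `α + |t|` has swept past the packet at `|t| = T`.  Proof: the original
one with `far_energy_le_at` in place of `near_energy_le_at`. -/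
theorem frozen_packet_far {M : ℝ} {r : ℝ → ℝ} (hM : 0 < M) (hr : ∀ x, 2 * M < r x)
    (hr' : ∀ x, HasDerivAt r (1 - 2 * M / r x) x) (xe : ℝ) {ε : ℝ} (hε : 0 < ε)
    {B : ℝ → ℝ} (hB : ContDiff ℝ 2 B) (h0l : ∀ u, u ≤ 0 → B u = 0)
    (h0r : ∀ u, 3 ≤ u → B u = 0) (h1 : ∀ u ∈ Icc (1 : ℝ) 2, B u = 1)
    (h01 : ∀ u, 0 ≤ B u ∧ B u ≤ 1) {K₂ : ℝ} (hK₂ : 0 ≤ K₂) (hB2 : ∀ u, |iteratedDeriv 2 B u| ≤ K₂)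
    {f₀ C₀ C₁ : ℝ} (hf₀ : 0 < f₀) (hC₁ : 0 ≤ C₁)
    (hlow : ∀ ℓ : ℕ, ∀ x ∈ Icc (xe - 3) xe, (ℓ : ℝ) * ((ℓ : ℝ) + 1) * f₀ - C₀ ≤ (1 - 2 * M / r x) *
        ((ℓ : ℝ) * ((ℓ : ℝ) + 1) / r x ^ 2 + (1 - ((2 : ℕ) : ℝ) ^ 2) * (2 * M) / r x ^ 3))
    (hlip : ∀ ℓ : ℕ, ∀ x ∈ Icc (xe - 3) xe, ∀ y ∈ Icc (xe - 3) xe,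
        |(1 - 2 * M / r x) *
            ((ℓ : ℝ) * ((ℓ : ℝ) + 1) / r x ^ 2 + (1 - ((2 : ℕ) : ℝ) ^ 2) * (2 * M) / r x ^ 3)
          - (1 - 2 * M / r y) *
            ((ℓ : ℝ) * ((ℓ : ℝ) + 1) / r y ^ 2 + (1 - ((2 : ℕ) : ℝ) ^ 2) * (2 * M) / r y ^ 3)|
          ≤ ((ℓ : ℝ) * ((ℓ : ℝ) + 1) + 1) * C₁ * |x - y|)
    {m : ℕ} (hm2 : 2 ≤ m) (hmC : 2 * C₀ / f₀ ≤ m)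
    (hmε : 108 * (9 * C₁ + K₂) ^ 2 / (ε * f₀) ≤ (m : ℝ) ^ 2)
    (ℓ : ℕ) (hℓ : ℓ = m ^ 4) (V : ℝ → ℝ)
    (hV : V = fun x => (1 - 2 * M / r x) *
      ((ℓ : ℝ) * ((ℓ : ℝ) + 1) / r x ^ 2 + (1 - ((2 : ℕ) : ℝ) ^ 2) * (2 * M) / r x ^ 3)) :
    ∃ (g : ℝ → ℝ) (α T : ℝ), ContDiff ℝ 2 g ∧ α < xe ∧ 0 < T ∧ (α = xe - T ∧ T = 3 / (m : ℝ) ^ 3) ∧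
      (∀ x, (x < α ∨ xe < x) → g x = 0) ∧ (∀ x, x ∉ Icc α xe → g x = 0) ∧
      (∀ x, xe ≤ x → g x = 0) ∧
      Integrable (fun x => g x ^ 2) ∧ 0 < ∫ x, g x ^ 2 ∧
      ∃ ψ : ℝ → ℝ → ℝ, ContDiff ℝ 2 (uncurry ψ) ∧
        (∀ t x, iteratedDeriv 2 (fun τ => ψ τ x) t - iteratedDeriv 2 (ψ t) x + V x * ψ t x = 0) ∧
        (∀ x, ψ 0 x = 0) ∧ (∀ x, deriv (fun τ => ψ τ x) 0 = g x) ∧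
        (∀ t x, (x < α - |t| ∨ xe + |t| < x) → ψ t x = 0) ∧
        (∀ t x, 0 ≤ deriv (fun τ => ψ τ x) t ^ 2 + deriv (ψ t) x ^ 2 + V x * ψ t x ^ 2) ∧
        (∀ t, Integrable fun x =>
          deriv (fun τ => ψ τ x) t ^ 2 + deriv (ψ t) x ^ 2 + V x * ψ t x ^ 2) ∧
        (∫ x in Ioi xe, (deriv (fun τ => ψ τ x) T ^ 2 + deriv (ψ T) x ^ 2 + V x * ψ T x ^ 2))
          ≤ ε * ∫ x, g x ^ 2 ∧
        (∫ x in Ioi xe, (deriv (fun τ => ψ τ x) (-T) ^ 2 + deriv (ψ (-T)) x ^ 2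
          + V x * ψ (-T) x ^ 2)) ≤ ε * ∫ x, g x ^ 2 := by
  -- scales
  have hm1 : (1 : ℝ) ≤ m := by exact_mod_cast (le_trans (by norm_num) hm2)
  have hm0 : (0 : ℝ) < m := by linarith
  set c : ℝ := (m : ℝ) ^ 3 with hc
  have hc0 : 0 < c := by positivity
  have hcm : (m : ℝ) ≤ c := by
    rw [hc]; nlinarith [mul_le_mul hm1 hm1 zero_le_one hm0.le]
  have hc1 : 1 ≤ c := hm1.trans hcm
  have h3c' : 3 / c ≤ 3 := by rw [div_le_iff₀ hc0]; nlinarith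
  have h3c0 : 0 < 3 / c := div_pos (by norm_num) hc0
  set ℓr : ℝ := (ℓ : ℝ) * ((ℓ : ℝ) + 1) with hℓr
  have hℓcast : (ℓ : ℝ) = (m : ℝ) ^ 4 := by rw [hℓ]; push_cast; ring
  have hℓr8 : (m : ℝ) ^ 8 ≤ ℓr := by
    rw [hℓr, hℓcast]; nlinarith [pow_nonneg hm0.le 4]
  have hℓr3 : ℓr + 1 ≤ 3 * (m : ℝ) ^ 8 := by
    rw [hℓr, hℓcast]
    have h4 : (1 : ℝ) ≤ (m : ℝ) ^ 4 := one_le_pow₀ hm1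
    nlinarith [pow_nonneg hm0.le 4]
  have hℓrm : (m : ℝ) ≤ ℓr := by
    refine le_trans ?_ hℓr8
    calc (m : ℝ) = (m : ℝ) ^ 1 := (pow_one _).symm
      _ ≤ (m : ℝ) ^ 8 := pow_le_pow_right₀ hm1 (by norm_num)
  have hℓr0 : 0 < ℓr := lt_of_lt_of_le hm0 hℓrm
  have hℓ2 : 2 ≤ ℓ := by
    rw [hℓ]; calc 2 ≤ 2 ^ 4 := by norm_num
      _ ≤ m ^ 4 := Nat.pow_le_pow_left hm2 4
  -- the potential
  subst hV
  have hV1 := contDiff_one_potential hM hr hr' ℓ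
  have hVpos := potential_pos hM hr hℓ2
  have hVnn : ∀ x, 0 ≤ (1 - 2 * M / r x) *
      ((ℓ : ℝ) * ((ℓ : ℝ) + 1) / r x ^ 2 + (1 - ((2 : ℕ) : ℝ) ^ 2) * (2 * M) / r x ^ 3) :=
    fun x => (hVpos x).le
  have hVb := abs_potential_le hM hr ℓ
  set Vf : ℝ → ℝ := fun x => (1 - 2 * M / r x) *
      ((ℓ : ℝ) * ((ℓ : ℝ) + 1) / r x ^ 2 + (1 - ((2 : ℕ) : ℝ) ^ 2) * (2 * M) / r x ^ 3) with hVf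
  -- the profile: `g(x) = B(c(x − α))`, `α = xe − 3/c`
  set α : ℝ := xe - 3 / c with hα
  have hαxe : α + 3 / c = xe := by rw [hα]; ring
  have hαlt : α < xe := by rw [hα]; linarith
  obtain ⟨hg2, hg0l, hg0r, hg1, hg01, hg''⟩ := scaled_profile hB h0l h0r h1 h01 hc0 α
  set g : ℝ → ℝ := fun x => B (c * (x - α)) with hg
  rw [hαxe] at hg0r
  have hgoff : ∀ x, x ∉ Icc α xe → g x = 0 := by
    intro x hx
    by_cases h : x ≤ α
    · exact hg0l x h
    · exact hg0r x (le_of_not_ge fun h' => hx ⟨le_of_not_ge h, h'⟩)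
  have hgoff' : ∀ x, (x < α ∨ xe < x) → g x = 0 :=
    fun x hx => hgoff x fun h => by rcases hx with hx | hx <;> linarith [h.1, h.2]
  have hgint : Integrable fun x => g x ^ 2 :=
    integrable_of_exterior (a := α) (b := xe) (hg2.continuous.pow 2)
      (fun x hx => by simp [hgoff' x hx])
  -- `∫ g² ≥ 1/c`
  have hE0low : 1 / c ≤ ∫ x, g x ^ 2 := by
    have hstep2 : (∫ x in Icc (α + 1 / c) (α + 2 / c), g x ^ 2) ≤ ∫ x, g x ^ 2 :=
      setIntegral_le_integral hgint (Eventually.of_forall fun x => sq_nonneg _)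
    refine le_trans (le_of_eq ?_) hstep2
    have h1c : α + 1 / c ≤ α + 2 / c := by
      have : 1 / c ≤ 2 / c := div_le_div_of_nonneg_right (by norm_num) hc0.le
      linarith
    rw [setIntegral_congr_fun measurableSet_Icc (g := fun _ => (1 : ℝ))
      (fun x hx => by rw [show g x = 1 from hg1 x hx]; norm_num), setIntegral_const,
      Real.volume_real_Icc_of_le h1c, smul_eq_mul, mul_one]
    ring
  have hE0pos : 0 < ∫ x, g x ^ 2 := lt_of_lt_of_le (by positivity) hE0low
  -- the solution with data `(0, g)`
  obtain ⟨ψ, hψ2, hsol, hψ0, hψ1, hsupp⟩ :=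
    CauchyWave.exists_solution (A := fun _ => 0) (B := g) (α := α) (β := xe) hV1 hVb
      contDiff_const (fun _ _ => rfl) (hg2.of_le (by norm_num)) hgoff
  have he0 : ∀ t x, 0 ≤ deriv (fun τ => ψ τ x) t ^ 2 + deriv (ψ t) x ^ 2 + Vf x * ψ t x ^ 2 :=
    fun t x => by have := mul_nonneg (hVnn x) (sq_nonneg (ψ t x)); positivity
  have hInt : ∀ t, Integrable fun x =>
      deriv (fun τ => ψ τ x) t ^ 2 + deriv (ψ t) x ^ 2 + Vf x * ψ t x ^ 2 :=
    fun t => integrable_energyDensity hV1.continuous hψ2 hsupp t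
  -- the frequency `ω² = V(α)` and the residual bound `ω N = 3(ℓr+1)C₁/c + c²K₂`
  set ω : ℝ := Real.sqrt (Vf α) with hω
  have hω0 : 0 < ω := Real.sqrt_pos.2 (hVpos α)
  have hω2 : ω ^ 2 = Vf α := Real.sq_sqrt (hVnn α)
  set N' : ℝ := 3 * (ℓr + 1) * C₁ / c + c ^ 2 * K₂ with hN'
  have hN'0 : 0 ≤ N' := by positivity
  set N : ℝ := N' / ω with hN
  have hN0 : 0 ≤ N := div_nonneg hN'0 hω0.le
  have hωN : ω * N = N' := by rw [hN]; field_simp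
  have hres_g : ∀ x, |(Vf x - ω ^ 2) * g x - iteratedDeriv 2 g x| ≤ ω * N := by
    intro x
    rw [hωN]
    by_cases hx : x ∈ Icc α xe
    · have hxK : x ∈ Icc (xe - 3) xe := ⟨by rw [hα] at hx; linarith [hx.1], hx.2⟩
      have hαK : α ∈ Icc (xe - 3) xe := ⟨by rw [hα]; linarith, hαlt.le⟩
      have hVd : |Vf x - Vf α| ≤ (ℓr + 1) * C₁ * (3 / c) := by
        refine (hlip ℓ x hxK α hαK).trans ?_
        rw [abs_of_nonneg (by linarith [hx.1])]
        exact mul_le_mul_of_nonneg_left (by rw [hα] at hx ⊢; linarith [hx.2]) (by positivity)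
      have hgx : |g x| ≤ 1 := by
        rw [abs_of_nonneg (hg01 x).1]; exact (hg01 x).2
      have hg''x : |iteratedDeriv 2 g x| ≤ c ^ 2 * K₂ := by
        rw [hg'' x, abs_mul, abs_of_nonneg (by positivity)]
        exact mul_le_mul_of_nonneg_left (hB2 _) (by positivity)
      rw [hω2]
      calc |(Vf x - Vf α) * g x - iteratedDeriv 2 g x|
          ≤ |(Vf x - Vf α) * g x| + |iteratedDeriv 2 g x| := abs_sub _ _
        _ = |Vf x - Vf α| * |g x| + |iteratedDeriv 2 g x| := by rw [abs_mul]
        _ ≤ (ℓr + 1) * C₁ * (3 / c) * 1 + c ^ 2 * K₂ :=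
            add_le_add (mul_le_mul hVd hgx (abs_nonneg _) (by positivity)) hg''x
        _ = N' := by rw [hN']; ring
    · have hx' : x < α ∨ xe < x := by
        by_contra h
        exact hx ⟨le_of_not_gt fun h' => h (Or.inl h'), le_of_not_gt fun h' => h (Or.inr h')⟩
      have hgev : g =ᶠ[𝓝 x] fun _ => (0 : ℝ) := by
        rcases hx' with hx' | hx'
        · filter_upwards [Iio_mem_nhds hx'] with y hy using hgoff' y (Or.inl hy)
        · filter_upwards [Ioi_mem_nhds hx'] with y hy using hgoff' y (Or.inr hy)
      rw [hgoff x hx, iteratedDeriv_two_eq_zero_of_eventuallyEq hgev]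
      simp [hN'0]
  -- the same bound for `−g` (data of the time-reversed solution)
  have hres_ng : ∀ x, |(Vf x - ω ^ 2) * (-g x) - iteratedDeriv 2 (fun y => -g y) x| ≤ ω * N := by
    intro x
    rw [iteratedDeriv_fun_neg 2 g x]
    have h := hres_g x
    rwa [← abs_neg, show -((Vf x - ω ^ 2) * g x - iteratedDeriv 2 g x)
      = (Vf x - ω ^ 2) * (-g x) - -iteratedDeriv 2 g x by ring] at h
  -- the near-side bounds at `T = 3/c` and `−T`
  set T : ℝ := 3 / c with hT
  have hTmem : T ∈ Icc 0 T := ⟨h3c0.le, le_rfl⟩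
  have hplus := far_energy_le_at hV1 hVnn hψ2 hsol hsupp hψ0 hψ1 hg2 hgoff' hαlt.le hω0 h3c0
    hres_g T hTmem
  obtain ⟨hψr2, hsolr, hsuppr, hψr0, hψr1, her⟩ := time_reverse hψ2 hsol hsupp hψ0 hψ1
  have hminus' := far_energy_le_at (ψ := fun s y => ψ (-s) y) hV1 hVnn hψr2 hsolr hsuppr hψr0
    hψr1 hg2.neg (fun x hx => by rw [hgoff' x hx, neg_zero]) hαlt.le hω0 h3c0 hres_ng T hTmem
  have hminus : (∫ x in Ioi xe, (deriv (fun τ => ψ τ x) (-T) ^ 2 + deriv (ψ (-T)) x ^ 2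
      + Vf x * ψ (-T) x ^ 2)) ≤ (Real.exp 1 - 1) * T ^ 2 * ((xe - α) * N ^ 2) := by
    rw [← setIntegral_congr_fun measurableSet_Ioi (fun x _ => her T x)]
    exact hminus'
  -- bookkeeping: `(e − 1) T² (xe − α) N² ≤ ε/c ≤ ε ∫ g²`
  have hexp2 : Real.exp 1 - 1 ≤ 2 := by
    have := Real.exp_one_lt_d9; norm_num at this; linarith
  have hexp0 : 0 ≤ Real.exp 1 - 1 := by linarith [Real.add_one_le_exp (1:ℝ)]
  have hN'D : N' ≤ (9 * C₁ + K₂) * (m : ℝ) ^ 6 := by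
    have ha : 3 * (ℓr + 1) * C₁ ≤ 9 * (m : ℝ) ^ 8 * C₁ := by
      have := mul_le_mul_of_nonneg_right hℓr3 hC₁
      linarith
    have hb : 3 * (ℓr + 1) * C₁ / c ≤ 9 * (m : ℝ) ^ 8 * C₁ / c :=
      div_le_div_of_nonneg_right ha hc0.le
    have hc' : 9 * (m : ℝ) ^ 8 * C₁ / c = 9 * C₁ * (m : ℝ) ^ 5 := by
      rw [div_eq_iff hc0.ne', hc]; ring
    have hd : 9 * C₁ * (m : ℝ) ^ 5 ≤ 9 * C₁ * (m : ℝ) ^ 6 :=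
      mul_le_mul_of_nonneg_left (pow_le_pow_right₀ hm1 (by norm_num)) (by positivity)
    have he : c ^ 2 * K₂ = K₂ * (m : ℝ) ^ 6 := by rw [hc]; ring
    rw [hN', he]
    linarith
  -- `ω² ≥ ℓr f₀ / 2 ≥ m⁸ f₀ / 2`
  have hω2low : (m : ℝ) ^ 8 * f₀ / 2 ≤ ω ^ 2 := by
    rw [hω2]
    have hαK : α ∈ Icc (xe - 3) xe := ⟨by rw [hα]; linarith, hαlt.le⟩
    have h := hlow ℓ α hαK
    have hℓf : 2 * C₀ ≤ ℓr * f₀ := by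
      have h1 : 2 * C₀ ≤ (m : ℝ) * f₀ := by rwa [div_le_iff₀ hf₀] at hmC
      exact h1.trans (mul_le_mul_of_nonneg_right hℓrm hf₀.le)
    have h8 : (m : ℝ) ^ 8 * f₀ ≤ ℓr * f₀ := mul_le_mul_of_nonneg_right hℓr8 hf₀.le
    refine le_trans ?_ h
    change (m : ℝ) ^ 8 * f₀ / 2 ≤ ℓr * f₀ - C₀
    linarith
  -- `N² ≤ 2 (9C₁+K₂)² m⁴ / f₀`
  have hN2 : N ^ 2 ≤ 2 * (9 * C₁ + K₂) ^ 2 * (m : ℝ) ^ 4 / f₀ := by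
    have hD : 0 ≤ 9 * C₁ + K₂ := by positivity
    have h1 : N ^ 2 = N' ^ 2 / ω ^ 2 := by rw [hN, div_pow]
    have h2 : N' ^ 2 ≤ (9 * C₁ + K₂) ^ 2 * (m : ℝ) ^ 12 := by
      calc N' ^ 2 ≤ ((9 * C₁ + K₂) * (m : ℝ) ^ 6) ^ 2 := pow_le_pow_left₀ hN'0 hN'D 2
        _ = (9 * C₁ + K₂) ^ 2 * (m : ℝ) ^ 12 := by ring
    rw [h1, div_le_div_iff₀ (by positivity) hf₀]
    calc N' ^ 2 * f₀ ≤ (9 * C₁ + K₂) ^ 2 * (m : ℝ) ^ 12 * f₀ :=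
          mul_le_mul_of_nonneg_right h2 hf₀.le
      _ = 2 * (9 * C₁ + K₂) ^ 2 * (m : ℝ) ^ 4 * ((m : ℝ) ^ 8 * f₀ / 2) := by ring
      _ ≤ 2 * (9 * C₁ + K₂) ^ 2 * (m : ℝ) ^ 4 * ω ^ 2 :=
          mul_le_mul_of_nonneg_left hω2low (by positivity)
  have hkey : (Real.exp 1 - 1) * T ^ 2 * ((xe - α) * N ^ 2) ≤ ε * ∫ x, g x ^ 2 := by
    have hxeα : xe - α = 3 / c := by rw [hα]; ring
    have hcc : c ^ 3 = (m : ℝ) ^ 9 := by rw [hc]; ring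
    -- the largeness condition `108 (9C₁+K₂)² ≤ ε f₀ m²`
    have hm' : 108 * (9 * C₁ + K₂) ^ 2 ≤ ε * f₀ * (m : ℝ) ^ 2 := by
      have h := hmε
      rw [div_le_iff₀ (mul_pos hε hf₀)] at h
      linarith only [h]
    have hstep : (Real.exp 1 - 1) * T ^ 2 * ((xe - α) * N ^ 2) ≤ ε * (1 / c) := by
      rw [hxeα, hT]
      calc (Real.exp 1 - 1) * (3 / c) ^ 2 * (3 / c * N ^ 2)
          = (Real.exp 1 - 1) * (27 * N ^ 2 / c ^ 3) := by field_simp; ring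
        _ ≤ 2 * (27 * N ^ 2 / c ^ 3) := mul_le_mul_of_nonneg_right hexp2 (by positivity)
        _ ≤ 2 * (27 * (2 * (9 * C₁ + K₂) ^ 2 * (m : ℝ) ^ 4 / f₀) / c ^ 3) := by gcongr
        _ = 108 * (9 * C₁ + K₂) ^ 2 * (m : ℝ) ^ 4 / (f₀ * (m : ℝ) ^ 9) := by
            rw [hcc]; field_simp; ring
        _ ≤ ε * f₀ * (m : ℝ) ^ 2 * (m : ℝ) ^ 4 / (f₀ * (m : ℝ) ^ 9) := by gcongr
        _ = ε * (1 / c) := by rw [hc]; field_simp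
    exact hstep.trans (mul_le_mul_of_nonneg_left hE0low hε.le)
  -- assemble
  refine ⟨g, α, T, hg2, hαlt, h3c0, ⟨by rw [hT, hα], by rw [hT, hc]⟩, hgoff', hgoff, hg0r, hgint,
    hE0pos, ψ, hψ2,
    hsol, hψ0, hψ1, hsupp, he0, hInt, hplus.trans hkey, hminus.trans hkey⟩

end Summit.FinalStateConjecture.FinalStateConjecture.Theorems.FrozenPacket

end
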